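import Literature.AnabelianGeometry.AbsoluteAnabelian.AbsTopIProp410NodeProofs
import Literature.AnabelianGeometry.SemiGraphs.TemperedOpenMapping
import Literature.GroupTheory.CombinatorialGroupTheory.VirtuallyFreeResiduallyFinite
import HarnessLib

/-!
# [AbsTopI] Prop 4.10 (i)/(iii): PROFINITE CLOSEDNESS of `H′^{co-fr}` in `Π^tp_Y` — residue (PC)
# of row iii.L02 PROVED at genuine data (proof-only)

S. Mochizuki, *Topics in Absolute Anabelian Geometry I: Generalities* [AbsTopI] (J. Math. Sci.
Univ. Tokyo 19 (2012)), §0 p. 8 (the `(Q, Δ)`-co-free completion; "every characteristic open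
subgroup of finite index `H ⊆ Δ` admits a minimal co-free subgroup `H^{co-fr} ⊆ H`"), Prop 4.10
(i) p. 60 ("`π₁^tp(X)` [...] is naturally isomorphic to its `π₁(X)`-co-free completion") and
(iii) p. 60; manuscript pagination, lit key `paper:url-11ac98ba15fc`, read on the page.
S. Mochizuki, *Semi-graphs of anabelioids* [SemiAnbd] Def 3.1 (i) p. 33 (tempered groups), §6
p. 69 ("`1 → Δ^temp → Π^temp → G_K → 1`"; "natural injection `Π^temp ↪ Π`" from residual
finiteness of free groups).  Lyndon–Schupp, *Combinatorial Group Theory* Ch. I §3.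

Context: row iii.L02 of the cell's sub-DAG `HOME/plan/L4/SUBDAG-AbsTopI-Prop410.md`.  The file
`AbsTopIProp410SelfCompletionProofs.lean` reduced `SelfCompletionAt Y` (Prop 4.10 (i) at the
construction — the input of every assembly of node (iii)) to the neighbourhood-basis condition
(CF′) "every open normal `N ≤ Π^tp_Y` contains some `K_{H′} := toHat⁻¹(closure toHat(H′^{co-fr}))`"
and SPLIT it (`piKer_cofinal_of_cofreeCore_cofinal`) into André's (CF) "every open normal `N`
contains some `H′^{co-fr}`" and the PROFINITE CLOSEDNESS

  (PC)  `K_{H′} ⊆ H′^{co-fr}` (so `K_{H′} = H′^{co-fr}`: `H′^{co-fr}` is closed in the profinite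
        topology of `Π^tp_Y`; `⊇` is `cofreeCore_le_ker_toCoFreeQuot`),

left there as the hypothesis `hPC`.  THIS FILE PROVES (PC) for every Y-index `H′`
(`piKer_le_cofreeCore`, `piKer_eq_cofreeCore`) from abc-iut-L3's parameter bundle
`dY : Y.GroupLevelData` ("`Π^tp` tempered, Galois-countable") and §0 p. 8's standing hypothesis
for `H′` ("admits a minimal co-free subgroup") ALONE: `Π^tp_Y / H′^{co-fr}` is residually finite
through OPEN subgroups (`exists_openNormal_finiteIndex_not_mem_of_not_mem_cofreeCore`: an open
normal `N₁ ⊇ H′^{co-fr}` with `N₁ ∩ Δ = H′^{co-fr}` exists by temperedness, `Π^tp_Y / N₁` is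
VIRTUALLY FREE — `H′N₁/N₁ ≅ H′/H′^{co-fr}` free of finite index, by co-freeness, the open mapping
theorem for `aug` and compactness of `G_K` — hence residually finite by the tree's
`residuallyFinite_of_isFreeGroup_of_index_ne_zero`, Lyndon–Schupp I §3; elements of
`N₁ ∖ H′^{co-fr}` lie outside `Δ` and are separated in the profinite `G_K`), and
`IsProfiniteCompletion.comap_surjective` turns an open normal finite-index `N ⊇ H′^{co-fr}` missing
`z` into `toHat z ∉ Ĥ′^{co-fr}`.

CONSEQUENCES: (CF′) from (CF) (`piKer_cofinal_of_cofreeCore_cofinal'`), `SelfCompletionAt Y`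
from (CF) (`selfCompletionAt_of_cofreeCore_cofinal`), and BOTH clauses of node (iii) at the
construction with (CF′) replaced by (CF): `prop410iiiAt_of_residues''`,
`prop410iiiDeltaAt_of_residues''` over {(CF), hleft, tfg `Δ̂_X`, `X.K = Y.K`, GroupLevelData ×2,
(R2), hmin} — the residue (CF′) of GAP row G-L4t13g5-1 is reduced to André's description of the
tempered topology ("`Π^tp = lim Π^tp/H^{co-fr}`").

Inputs are hypotheses stated in the signatures (no new named facts; FACT-LIST untouched).  HONEST
FRAMING: refereed prerequisite papers; nothing here bears on [IUTchIII] Cor 3.12; typed ≠ proved.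
-/

noncomputable section

open _root_.Topology Filter

namespace Literature.AnabelianGeometry.AbsoluteAnabelian.AbsTopI.Prop410

open Literature.AnabelianGeometry.SemiGraphs
open Literature.AnabelianGeometry.AbsoluteAnabelian.AbsTopI
open Literature.GroupTheory.CombinatorialGroupTheory

variable {p : ℕ} [Fact p.Prime]

/-! ### The augmentation: `Ker(augGK) = Δ^tp`, and `Δ^tp · N` has finite index for open `N` -/

/-- `Ker(augGK) = Δ^tp_Y` (`Δ^tp = Ker(aug)`, §6 p. 69). [cite: MochizukiSemiAnbd2006, §6 p.69] -/
theorem ker_augGK_eq_deltaTemp (Y : TemperedCurve p) : Y.augGK.toMonoidHom.ker = Y.DeltaTemp := by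
  ext g
  rw [MonoidHom.mem_ker]
  change Y.augGK g = 1 ↔ _
  rw [Subtype.ext_iff, TemperedCurve.coe_augGK_apply]
  exact Iff.rfl

/-- `G_K` is compact (a closed — because open — subgroup of the compact `G_{ℚ_p}`).
[cite: MochizukiSemiAnbd2006, §6 p.69] -/
theorem compactSpace_GK' (Y : TemperedCurve p) : CompactSpace Y.GK := by
  haveI : IsGalois ℚ_[p] (AlgebraicClosure ℚ_[p]) := {}
  haveI := Y.finiteDimensional_K
  have hclosed : IsClosed (Y.GK : Set (GQp p)) :=
    OpenSubgroup.isClosed ⟨Y.GK, IntermediateField.fixingSubgroup_isOpen Y.K⟩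
  exact isCompact_iff_compactSpace.1 hclosed.isCompact

/-- For `Π^tp_Y` tempered and Galois-countable, `Δ^tp_Y · N` has FINITE index in `Π^tp_Y` for
every open subgroup `N`: its image `aug(N)` is open (open mapping theorem) in the compact `G_K`.
[cite: MochizukiSemiAnbd2006, §6 p.69] -/
theorem index_deltaTemp_sup_ne_zero (Y : TemperedCurve p) (hT : IsTempered Y.PiTemp)
    [FirstCountableTopology Y.PiTemp] (N : Subgroup Y.PiTemp) (hN : IsOpen (N : Set Y.PiTemp)) :
    (Y.DeltaTemp ⊔ N).index ≠ 0 := by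
  haveI := compactSpace_GK' Y
  have hopen : IsOpen ((N.map Y.augGK.toMonoidHom : Subgroup Y.GK) : Set Y.GK) := by
    rw [Subgroup.coe_map]
    exact Y.isOpenMap_augGK_of_isTempered hT _ hN
  haveI : Finite (Y.GK ⧸ (N.map Y.augGK.toMonoidHom)) :=
    Subgroup.quotient_finite_of_isOpen _ hopen
  haveI : (N.map Y.augGK.toMonoidHom).FiniteIndex := Subgroup.finiteIndex_of_finite_quotient
  have h : Y.DeltaTemp ⊔ N = (N.map Y.augGK.toMonoidHom).comap Y.augGK.toMonoidHom := by
    rw [Subgroup.comap_map_eq, ker_augGK_eq_deltaTemp, sup_comm]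
  rw [h, Subgroup.index_comap_of_surjective _ Y.augGK_surjective]
  exact Subgroup.FiniteIndex.index_ne_zero

/-! ### Separation of elements outside `Δ^tp_Y` by open normal subgroups of finite index -/

/-- An element of `Π^tp_Y` NOT in `Δ^tp_Y` lies outside some open normal subgroup of finite index
containing `Δ^tp_Y`: its image in the profinite group `G_K` is `≠ 1`, and open normal subgroups of
a profinite group separate points ([SemiAnbd] Rmk 3.1.1: "every profinite group is tempered").
[cite: MochizukiSemiAnbd2006, Rmk 3.1.1 p.33] -/
theorem exists_openNormal_finiteIndex_not_mem_of_not_mem_deltaTemp (Y : TemperedCurve p)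
    {z : Y.PiTemp} (hz : z ∉ Y.DeltaTemp) :
    ∃ N : OpenNormalSubgroup Y.PiTemp, N.toSubgroup.FiniteIndex ∧
      Y.DeltaTemp ≤ N.toSubgroup ∧ z ∉ N.toSubgroup := by
  classical
  haveI : IsGalois ℚ_[p] (AlgebraicClosure ℚ_[p]) := {}
  haveI : T2Space (GQp p) := krullTopology_t2
  haveI := compactSpace_GK' Y
  have hz1 : Y.augGK z ≠ 1 := fun h => hz (by rw [← ker_augGK_eq_deltaTemp]; exact h)
  obtain ⟨H, hH⟩ := (IsTempered.of_profinite (G := Y.GK)).separated _ hz1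
  haveI : Finite (Y.GK ⧸ H.toSubgroup) := Subgroup.quotient_finite_of_isOpen _ H.isOpen
  haveI : H.toSubgroup.FiniteIndex := Subgroup.finiteIndex_of_finite_quotient
  have hNopen : IsOpen ((H.toSubgroup.comap Y.augGK.toMonoidHom : Subgroup Y.PiTemp) :
      Set Y.PiTemp) := H.isOpen.preimage Y.augGK.continuous
  have hNfin : (H.toSubgroup.comap Y.augGK.toMonoidHom).FiniteIndex := by
    refine ⟨?_⟩
    rw [Subgroup.index_comap_of_surjective _ Y.augGK_surjective]
    exact Subgroup.FiniteIndex.index_ne_zero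
  refine ⟨⟨⟨H.toSubgroup.comap Y.augGK.toMonoidHom, hNopen⟩, inferInstance⟩, hNfin, ?_,
    fun hzN => hH hzN⟩
  rw [← ker_augGK_eq_deltaTemp]
  exact MonoidHom.ker_le_comap _ _

/-! ### The discrete quotient `Π^tp_Y / N₁` is virtually free, hence residually finite -/

/-- **`Π^tp_Y / N₁` is residually finite** for an open normal `N₁` with `H′^{co-fr} ≤ N₁` and
`N₁ ∩ Δ^tp_Y ⊆ H′^{co-fr}` (`H′` a Y-index admitting a minimal co-free subgroup, [AbsTopI] §0 p. 8):
the image of `H′` is the FREE group `H′/H′^{co-fr}` ("the quotient `H/H^{co-fr}` is a free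
discrete group") and has finite index (`[Π : Δ·N₁] < ∞` by `index_deltaTemp_sup_ne_zero`,
`[Δ : H′] < ∞`), so the quotient is virtually free and the tree's
`residuallyFinite_of_isFreeGroup_of_index_ne_zero` (free groups are residually finite,
Lyndon–Schupp Ch. I §3) applies. [cite: MochizukiAbsTopI2012, §0 p.8] -/
theorem residuallyFinite_quotient_of_inf_deltaTemp_le {Y : TemperedCurve p} (dY : Y.GroupLevelData)
    (H' : CharOpenSubgroup Y.DeltaTemp) {M : Subgroup Y.PiTemp}
    (hM : IsMinimalCofreeIn H'.toSubgroup M) (N₁ : OpenNormalSubgroup Y.PiTemp)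
    (hle : cofreeCore H'.toSubgroup ≤ N₁.toSubgroup)
    (hinf : ∀ x ∈ N₁.toSubgroup, x ∈ Y.DeltaTemp → x ∈ cofreeCore H'.toSubgroup) :
    Group.ResiduallyFinite (Y.PiTemp ⧸ N₁.toSubgroup) := by
  classical
  haveI := dY.secondCountableTopology
  obtain ⟨-, hMn, hcf⟩ := hM.1
  have hCM : cofreeCore H'.toSubgroup = M := cofreeCore_eq_of_isMinimalCofreeIn hM
  let π : Y.PiTemp →* Y.PiTemp ⧸ N₁.toSubgroup := QuotientGroup.mk' N₁.toSubgroup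
  have hπs : Function.Surjective π := QuotientGroup.mk'_surjective _
  have hker : π.ker = N₁.toSubgroup := QuotientGroup.ker_mk' _
  let F : Subgroup (Y.PiTemp ⧸ N₁.toSubgroup) := H'.toSubgroup.map π
  -- `N₁ ∩ H′ = H′^{co-fr} = M`
  have hsub : N₁.toSubgroup.subgroupOf H'.toSubgroup = M.subgroupOf H'.toSubgroup := by
    ext x
    simp only [Subgroup.mem_subgroupOf]
    constructor
    · intro hx
      rw [← hCM]
      exact hinf x hx (H'.le x.2)
    · intro hx
      apply hle
      rw [hCM]
      exact hx
  -- the image of `H′` is free: `F ≅ H′ / (N₁ ∩ H′) = H′ / H′^{co-fr}`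
  haveI : IsFreeGroup F := by
    haveI := hMn
    haveI := hcf.isFreeGroup_quotient
    have hkerr : M.subgroupOf H'.toSubgroup = (π.restrict H'.toSubgroup).ker := by
      rw [MonoidHom.ker_restrict, hker, hsub]
    have e1 : (H'.toSubgroup ⧸ M.subgroupOf H'.toSubgroup) ≃*
        (H'.toSubgroup ⧸ (π.restrict H'.toSubgroup).ker) :=
      QuotientGroup.quotientMulEquivOfEq hkerr
    have e2 : (H'.toSubgroup ⧸ (π.restrict H'.toSubgroup).ker) ≃*
        (π.restrict H'.toSubgroup).range :=
      QuotientGroup.quotientKerEquivRange _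
    have e3 : (π.restrict H'.toSubgroup).range ≃* F :=
      MulEquiv.subgroupCongr (MonoidHom.restrict_range H'.toSubgroup π)
    exact IsFreeGroup.ofMulEquiv (e1.trans (e2.trans e3))
  -- the image of `H′` has finite index
  have hF : F.index ≠ 0 := by
    have hFD : F ≤ Y.DeltaTemp.map π := Subgroup.map_mono H'.le
    rw [← Subgroup.relIndex_mul_index hFD]
    refine mul_ne_zero ?_ ?_
    · -- `[Δ·N₁ : H′·N₁] ∣ [Δ : H′]`
      have h1 : F.relIndex (Y.DeltaTemp.map π) =
          (H'.toSubgroup ⊔ N₁.toSubgroup).relIndex Y.DeltaTemp := by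
        rw [← Subgroup.relIndex_comap, Subgroup.comap_map_eq, hker]
      rw [h1]
      have h2 : (H'.toSubgroup ⊔ N₁.toSubgroup).relIndex Y.DeltaTemp ∣
          H'.toSubgroup.relIndex Y.DeltaTemp :=
        Subgroup.relIndex_dvd_of_le_left Y.DeltaTemp le_sup_left
      refine ne_zero_of_dvd_ne_zero ?_ h2
      haveI := H'.finiteIndex
      exact Subgroup.FiniteIndex.index_ne_zero
    · -- `[Π : Δ·N₁] < ∞`
      rw [← Subgroup.index_comap_of_surjective _ hπs, Subgroup.comap_map_eq, hker]
      exact index_deltaTemp_sup_ne_zero Y dY.isTempered N₁.toSubgroup N₁.isOpen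
  exact residuallyFinite_of_isFreeGroup_of_index_ne_zero F hF

/-! ### Separation of elements outside `H′^{co-fr}` by open normal subgroups of finite index -/

/-- **Key lemma**: for a Y-index `H′` admitting a minimal co-free subgroup ([AbsTopI] §0 p. 8)
and `Π^tp_Y` tempered, Galois-countable, every `z ∉ H′^{co-fr}` lies outside some OPEN normal
subgroup `N` of FINITE index with `H′^{co-fr} ≤ N` — i.e. `Π^tp_Y / H′^{co-fr}` is residually
finite through open subgroups.  (Temperedness gives an open normal `N₀` with `N₀ ∩ Δ ⊆ H′^{co-fr}`;
`N₁ := N₀·H′^{co-fr}` has `N₁ ∩ Δ = H′^{co-fr}` and a virtually free, hence residually finite,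
quotient; elements of `N₁ ∖ H′^{co-fr}` lie outside `Δ` and are separated in `G_K`.)
[cite: MochizukiAbsTopI2012, §0 p.8] -/
theorem exists_openNormal_finiteIndex_not_mem_of_not_mem_cofreeCore {Y : TemperedCurve p}
    (dY : Y.GroupLevelData) (H' : CharOpenSubgroup Y.DeltaTemp) {M : Subgroup Y.PiTemp}
    (hM : IsMinimalCofreeIn H'.toSubgroup M) {z : Y.PiTemp} (hz : z ∉ cofreeCore H'.toSubgroup) :
    ∃ N : OpenNormalSubgroup Y.PiTemp, N.toSubgroup.FiniteIndex ∧
      cofreeCore H'.toSubgroup ≤ N.toSubgroup ∧ z ∉ N.toSubgroup := by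
  classical
  haveI : Y.DeltaTemp.Normal := by
    unfold TemperedCurve.DeltaTemp
    infer_instance
  haveI hCn : (cofreeCore H'.toSubgroup).Normal := cofreeCore_normal_of_charOpen H'
  have hCΔ : cofreeCore H'.toSubgroup ≤ Y.DeltaTemp := (cofreeCore_le _).trans H'.le
  -- Step 1: an open normal `N₀` with `N₀ ∩ Δ ⊆ H′^{co-fr}` (temperedness; `H′^{co-fr}` open in `Δ`)
  have hopen : IsOpen (((cofreeCore H'.toSubgroup).subgroupOf Y.DeltaTemp :
      Subgroup Y.DeltaTemp) : Set Y.DeltaTemp) := isOpen_cofreeCore_subgroupOf H' hM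
  obtain ⟨U, hUo, hUC⟩ := isOpen_induced_iff.mp hopen
  have h1U : (1 : Y.PiTemp) ∈ U := by
    have h1 : (1 : Y.DeltaTemp) ∈ Subtype.val ⁻¹' U := by rw [hUC]; exact Subgroup.one_mem _
    exact h1
  obtain ⟨N₀, -, hN₀U⟩ := dY.isTempered.basis U (hUo.mem_nhds h1U)
  have hN₀ : ∀ x ∈ N₀.toSubgroup, x ∈ Y.DeltaTemp → x ∈ cofreeCore H'.toSubgroup := by
    intro x hx hxΔ
    have hx' : (⟨x, hxΔ⟩ : Y.DeltaTemp) ∈ Subtype.val ⁻¹' U := hN₀U hx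
    rw [hUC] at hx'
    exact Subgroup.mem_subgroupOf.mp hx'
  -- Step 2: `N₁ := N₀ · H′^{co-fr}`, open normal, `N₁ ∩ Δ = H′^{co-fr}`
  have hN₁open : IsOpen ((N₀.toSubgroup ⊔ cofreeCore H'.toSubgroup : Subgroup Y.PiTemp) :
      Set Y.PiTemp) := Subgroup.isOpen_mono le_sup_left N₀.isOpen
  let N₁ : OpenNormalSubgroup Y.PiTemp :=
    ⟨⟨N₀.toSubgroup ⊔ cofreeCore H'.toSubgroup, hN₁open⟩, inferInstance⟩
  have hN₁eq : N₁.toSubgroup = N₀.toSubgroup ⊔ cofreeCore H'.toSubgroup := rfl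
  have hCN₁ : cofreeCore H'.toSubgroup ≤ N₁.toSubgroup := by
    rw [hN₁eq]
    exact le_sup_right
  have hN₁Δ : ∀ x ∈ N₁.toSubgroup, x ∈ Y.DeltaTemp → x ∈ cofreeCore H'.toSubgroup := by
    intro x hx hxΔ
    have hx' : x ∈ ((N₀.toSubgroup ⊔ cofreeCore H'.toSubgroup : Subgroup Y.PiTemp) :
        Set Y.PiTemp) := by
      rw [← hN₁eq]
      exact hx
    rw [Subgroup.mul_normal] at hx'
    obtain ⟨n, hn, c, hc, rfl⟩ := Set.mem_mul.mp hx'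
    have hnΔ : n ∈ Y.DeltaTemp := by
      have h := Y.DeltaTemp.mul_mem hxΔ (Y.DeltaTemp.inv_mem (hCΔ hc))
      rwa [mul_inv_cancel_right] at h
    exact Subgroup.mul_mem _ (hN₀ n hn hnΔ) hc
  by_cases hzN₁ : z ∈ N₁.toSubgroup
  · -- then `z ∉ Δ`: separate in `G_K`
    have hzΔ : z ∉ Y.DeltaTemp := fun h => hz (hN₁Δ z hzN₁ h)
    obtain ⟨N, hfin, hΔN, hzN⟩ :=
      exists_openNormal_finiteIndex_not_mem_of_not_mem_deltaTemp Y hzΔ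
    exact ⟨N, hfin, hCΔ.trans hΔN, hzN⟩
  · -- `z ∉ N₁`: separate in the residually finite quotient `Π^tp_Y / N₁`
    haveI hRF : Group.ResiduallyFinite (Y.PiTemp ⧸ N₁.toSubgroup) :=
      residuallyFinite_quotient_of_inf_deltaTemp_le dY H' hM N₁ hCN₁ hN₁Δ
    let π : Y.PiTemp →* Y.PiTemp ⧸ N₁.toSubgroup := QuotientGroup.mk' N₁.toSubgroup
    have hπs : Function.Surjective π := QuotientGroup.mk'_surjective _
    have hz1 : π z ≠ 1 := fun h => hzN₁ ((QuotientGroup.eq_one_iff z).mp h)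
    obtain ⟨K, hK⟩ := Group.exists_finiteIndexNormalSubgroup_notMem (π z) hz1
    have hN₁K : N₁.toSubgroup ≤ K.toSubgroup.comap π := fun x hx => by
      have hx1 : π x = 1 := (QuotientGroup.eq_one_iff x).mpr hx
      rw [Subgroup.mem_comap, hx1]
      exact Subgroup.one_mem _
    have hKopen : IsOpen ((K.toSubgroup.comap π : Subgroup Y.PiTemp) : Set Y.PiTemp) :=
      Subgroup.isOpen_mono hN₁K N₁.isOpen
    have hKfin : (K.toSubgroup.comap π).FiniteIndex := by
      refine ⟨?_⟩
      rw [Subgroup.index_comap_of_surjective _ hπs]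
      exact Subgroup.FiniteIndex.index_ne_zero
    refine ⟨⟨⟨K.toSubgroup.comap π, hKopen⟩, inferInstance⟩, hKfin, hCN₁.trans hN₁K, ?_⟩
    intro hzK
    exact hK (FiniteIndexNormalSubgroup.mem_toSubgroup_iff.mp (Subgroup.mem_comap.mp hzK))

/-! ### (PC): `K_{H′} = H′^{co-fr}` -/

/-- **(PC) PROVED — `H′^{co-fr}` is closed in the profinite topology of `Π^tp_Y`**: for `Π^tp_Y`
tempered and Galois-countable (`dY : Y.GroupLevelData`) and a Y-index `H′` admitting a minimal
co-free subgroup ([AbsTopI] §0 p. 8), `K_{H′} := Ker(Π^tp_Y → Π̂_Y ⧸ Ĥ′^{co-fr}) ⊆ H′^{co-fr}`.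
With an open normal finite-index `N ⊇ H′^{co-fr}` missing `z` (previous lemma), `N = toHat⁻¹(V)`
for an open normal `V ≤ Π̂_Y` (`IsProfiniteCompletion.comap_surjective`), and `V` is a closed
normal subgroup containing `toHat(H′^{co-fr})`, hence `Ĥ′^{co-fr}`.
[cite: MochizukiAbsTopI2012, Prop 4.10 (i) p.60] -/
theorem piKer_le_cofreeCore {Y : TemperedCurve p} (dY : Y.GroupLevelData)
    (H' : CharOpenSubgroup Y.DeltaTemp) {M : Subgroup Y.PiTemp}
    (hM : IsMinimalCofreeIn H'.toSubgroup M) :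
    CoFreeCompletion.piKer ((ContinuousMonoidHom.id Y.PiHat).comp Y.toHat) Y.DeltaTemp H' ≤
      cofreeCore H'.toSubgroup := by
  intro z hz
  by_contra hzC
  obtain ⟨N, hfin, hCN, hzN⟩ :=
    exists_openNormal_finiteIndex_not_mem_of_not_mem_cofreeCore dY H' hM hzC
  obtain ⟨V, hV⟩ := Y.isProfiniteCompletion_toHat.comap_surjective N hfin
  -- `Ĥ′^{co-fr} ≤ V`
  have hCV : coFreeKernel ((ContinuousMonoidHom.id Y.PiHat).comp Y.toHat) H'.toSubgroup ≤
      V.toSubgroup := by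
    refine Subgroup.topologicalClosure_minimal _ ?_ V.isClosed
    refine Subgroup.normalClosure_le_normal ?_
    rintro _ ⟨c, hc, rfl⟩
    have hcN : c ∈ N.toSubgroup := hCN hc
    rw [hV] at hcN
    exact hcN
  -- `toHat z ∈ Ĥ′^{co-fr} ≤ V`, so `z ∈ toHat⁻¹(V) = N`
  have hz' : ((ContinuousMonoidHom.id Y.PiHat).comp Y.toHat) z ∈
      coFreeKernel ((ContinuousMonoidHom.id Y.PiHat).comp Y.toHat) H'.toSubgroup :=
    (QuotientGroup.eq_one_iff _).mp ((MonoidHom.mem_ker).mp hz)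
  exact hzN (by rw [hV]; exact hCV hz')

/-- **`K_{H′} = H′^{co-fr}`** at genuine data (the two inclusions: (PC) and
`cofreeCore_le_ker_toCoFreeQuot`): `Im_{Π̂_Y}(Π^tp_Y/H′^{co-fr}) ≅ Π^tp_Y ⧸ K_{H′}` IS
`Π^tp_Y/H′^{co-fr}`, i.e. `Π^tp_Y/H′^{co-fr}` injects into `Π̂_Y ⧸ Ĥ′^{co-fr}` (the
residual-finiteness content of [AbsTopI] Prop 4.10 (i)).
[cite: MochizukiAbsTopI2012, Prop 4.10 (i) p.60] -/
theorem piKer_eq_cofreeCore {Y : TemperedCurve p} (dY : Y.GroupLevelData)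
    (H' : CharOpenSubgroup Y.DeltaTemp) {M : Subgroup Y.PiTemp}
    (hM : IsMinimalCofreeIn H'.toSubgroup M) :
    CoFreeCompletion.piKer ((ContinuousMonoidHom.id Y.PiHat).comp Y.toHat) Y.DeltaTemp H' =
      cofreeCore H'.toSubgroup :=
  le_antisymm (piKer_le_cofreeCore dY H' hM) (cofreeCore_le_ker_toCoFreeQuot _ H'.toSubgroup)

/-! ### Consequences: (CF′), Prop 4.10 (i) from André's (CF); node (iii), reduced residues -/

/-- **(CF′) from (CF)** at genuine data: if every open normal subgroup of `Π^tp_Y` contains some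
`H′^{co-fr}` (André's description of the tempered topology, "`Π^tp = lim Π^tp/H^{co-fr}`"), then
every open normal subgroup contains some `K_{H′}` — `piKer_cofinal_of_cofreeCore_cofinal` with its
hypothesis (PC) DISCHARGED by `piKer_le_cofreeCore`.
[cite: MochizukiAbsTopI2012, Prop 4.10 (i) p.60] -/
theorem piKer_cofinal_of_cofreeCore_cofinal' {Y : TemperedCurve p} (dY : Y.GroupLevelData)
    (hmin : ∀ H' : CharOpenSubgroup Y.DeltaTemp, ∃ M, IsMinimalCofreeIn H'.toSubgroup M)
    (hbasis : ∀ N : OpenNormalSubgroup Y.PiTemp, ∃ H' : CharOpenSubgroup Y.DeltaTemp,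
      cofreeCore H'.toSubgroup ≤ N.toSubgroup)
    (N : OpenNormalSubgroup Y.PiTemp) :
    ∃ H' : CharOpenSubgroup Y.DeltaTemp,
      CoFreeCompletion.piKer ((ContinuousMonoidHom.id Y.PiHat).comp Y.toHat) Y.DeltaTemp H' ≤
        N.toSubgroup :=
  piKer_cofinal_of_cofreeCore_cofinal hbasis
    (fun H' => by
      obtain ⟨M, hM⟩ := hmin H'
      exact piKer_le_cofreeCore dY H' hM) N

/-- **[AbsTopI] Prop 4.10 (i) AT THE CONSTRUCTION (row iii.L02) from André's (CF) alone**, for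
`Π^tp_Y` tempered, Galois-countable and §0 p. 8's standing hypothesis for the Y-indices.
[cite: MochizukiAbsTopI2012, Prop 4.10 (i) p.60] -/
theorem selfCompletionAt_of_cofreeCore_cofinal {Y : TemperedCurve p} (dY : Y.GroupLevelData)
    (hmin : ∀ H' : CharOpenSubgroup Y.DeltaTemp, ∃ M, IsMinimalCofreeIn H'.toSubgroup M)
    (hbasis : ∀ N : OpenNormalSubgroup Y.PiTemp, ∃ H' : CharOpenSubgroup Y.DeltaTemp,
      cofreeCore H'.toSubgroup ≤ N.toSubgroup) :
    SelfCompletionAt Y :=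
  selfCompletionAt_of_groupLevelData dY (piKer_cofinal_of_cofreeCore_cofinal' dY hmin hbasis)

/-- **[AbsTopI] Prop 4.10 (iii), Π-clause, AT THE CONSTRUCTION over the REDUCED residues**: as
`prop410iiiAt_of_residues'` with (CF′) replaced by André's (CF) "every open normal `N ≤ Π^tp_Y`
contains some `H′^{co-fr}`". [cite: MochizukiAbsTopI2012, Prop 4.10 (iii) p.60] -/
theorem prop410iiiAt_of_residues'' {X Y : TemperedCurve p} (E : DeCuspidalization X Y)
    (hbasis : ∀ N : OpenNormalSubgroup Y.PiTemp, ∃ H' : CharOpenSubgroup Y.DeltaTemp,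
      cofreeCore H'.toSubgroup ≤ N.toSubgroup)
    (hleft : ∀ H : CharOpenSubgroup X.DeltaTemp, ∃ H' : CharOpenSubgroup Y.DeltaTemp,
      coFreeKernel ((ContinuousMonoidHom.id Y.PiHat).comp Y.toHat) H'.toSubgroup ≤
        coFreeKernel (E.fHat.comp X.toHat) H.toSubgroup)
    (hfg : IsTopologicallyFinitelyGenerated X.DeltaHat) (hK : X.K = Y.K)
    (dX : X.GroupLevelData) (dY : Y.GroupLevelData)
    (hR2 : ∀ H' : CharOpenSubgroup Y.DeltaTemp,
      H'.toSubgroup ≤ (H'.toSubgroup.comap E.f.toMonoidHom).map E.f.toMonoidHom ⊔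
        cofreeCore H'.toSubgroup)
    (hmin : ∀ H' : CharOpenSubgroup Y.DeltaTemp, ∃ M, IsMinimalCofreeIn H'.toSubgroup M) :
    Prop410iiiAt E :=
  prop410iiiAt_of_residues' E (piKer_cofinal_of_cofreeCore_cofinal' dY hmin hbasis) hleft hfg hK dX
    dY hR2 hmin

/-- **[AbsTopI] Prop 4.10 (iii), Δ-clause ("respectively, `Δ^tp_X → Δ^tp_Y`"), AT THE CONSTRUCTION
over the same REDUCED residues.** [cite: MochizukiAbsTopI2012, Prop 4.10 (iii) p.60] -/
theorem prop410iiiDeltaAt_of_residues'' {X Y : TemperedCurve p} (E : DeCuspidalization X Y)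
    (hbasis : ∀ N : OpenNormalSubgroup Y.PiTemp, ∃ H' : CharOpenSubgroup Y.DeltaTemp,
      cofreeCore H'.toSubgroup ≤ N.toSubgroup)
    (hleft : ∀ H : CharOpenSubgroup X.DeltaTemp, ∃ H' : CharOpenSubgroup Y.DeltaTemp,
      coFreeKernel ((ContinuousMonoidHom.id Y.PiHat).comp Y.toHat) H'.toSubgroup ≤
        coFreeKernel (E.fHat.comp X.toHat) H.toSubgroup)
    (hfg : IsTopologicallyFinitelyGenerated X.DeltaHat) (hK : X.K = Y.K)
    (dX : X.GroupLevelData) (dY : Y.GroupLevelData)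
    (hR2 : ∀ H' : CharOpenSubgroup Y.DeltaTemp,
      H'.toSubgroup ≤ (H'.toSubgroup.comap E.f.toMonoidHom).map E.f.toMonoidHom ⊔
        cofreeCore H'.toSubgroup)
    (hmin : ∀ H' : CharOpenSubgroup Y.DeltaTemp, ∃ M, IsMinimalCofreeIn H'.toSubgroup M) :
    Prop410iiiDeltaAt E :=
  prop410iiiDeltaAt_of_residues' E (piKer_cofinal_of_cofreeCore_cofinal' dY hmin hbasis) hleft hfg
    hK dX dY hR2 hmin

end Literature.AnabelianGeometry.AbsoluteAnabelian.AbsTopI.Prop410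

end
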